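import Mathlib.LinearAlgebra.Matrix.Charpoly.Coeff
import Mathlib.LinearAlgebra.Span.Basic
import Mathlib.LinearAlgebra.Finsupp.LinearCombination
import HarnessLib

/-!
# Cyclic vectors of a square matrix form a torsor under the units of `F[τ]`; over an order `O[τ]`: `O[τ]·w = O[τ]·w′ ⟺ w′ ∈ O[τ]^×·w` (Lang, *Algebra*, XIV §2–§3)

Topic `LinearAlgebra/Matrix`; namespace `Literature.LinearAlgebra.Matrix`.  THEOREMS ONLY (no definition, no instance, no notation, no named fact, no `sorry`); Mathlib-only.
Road «S3-tree» of cell `pub/hodgecm-mathlib` (crux H413 = `stmt-HodgeConjecture-24833`), T3′ population P-2 (architect A-82 (2), census F0P3a-p04 (g16) addendum 1bdd60a2 §(C) «(c2) the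
operator-currency identification «cyclic vectors of `δ_w` form an `L_w[δ_w]^×`-torsor; `R·w = R·w′ ⟺ w′ ∈ R^×·w`» over ANY field»); organ by F0P3-p03 (g13).  OPERATOR CURRENCY = the Krylov
currency of ★ O5∕(D0) `ResiduallyUnipotentCyclicLattices` (A-p12 (g21)): a matrix `τ ∈ M_n(F)`, the Krylov family `j ↦ τ^j w`, the span `F·{τ^j w} = ⊤` («`w` cyclic»), and for a subring
`O ≤ F` with `χ_τ ∈ O[X]` the lattice `O·{τ^j w : j < n} = O[τ]·w`.  No eigenframe, no diagonalisation: serves the type-(2) population (`χ_g` irreducible) verbatim.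
HONEST LABEL: HC_CM is proved only modulo the printed citations (2 remaining named inputs hLiu418, h413) until rung 0 closes; pure linear algebra, pays no letter.

THE PRINT. [Lang2002, Ch. XIV §2 Thm. 2.1 ∕ §3 (pp. 556–563)]: `V` is a cyclic `F[X]`-module via `τ` iff `V ≅ F[X]∕(χ_τ)`; then `End_{F[τ]}(V) = F[τ] ≅ F[X]∕(χ_τ)` acts simply
transitively on the generators (cyclic vectors), whose stabiliser is trivial: the cyclic vectors form an `F[τ]^×`-TORSOR.  Restricting scalars to an order `O[τ]` (`χ_τ ∈ O[X]`, so `O[τ] =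
⊕_{j<n} O τ^j` by Cayley–Hamilton): `O[τ]·w = O[τ]·w′` for cyclic `w, w′` iff the transporter `w′ = P w` (unique `P ∈ F[τ]`) lies in `O[τ]` together with its inverse.

* §1 `mulVec_eq_zero_of_commute_of_cyclic` (FAITHFULNESS: `Aτ = τA`, `A w = 0`, `w` cyclic ⇒ `A = 0`), `eq_of_commute_of_mulVec_eq`; `exists_aeval_mulVec_eq` (TRANSITIVITY: every `w′` is
  `p(τ) w`); **`cyclic_iff_isUnit_aeval`** (`p(τ) w` is cyclic ⟺ `p(τ)` is a unit — THE TORSOR).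
* §2 (order `O ≤ F`, `∀ i, χ_τ.coeff i ∈ O`) `pow_mulVec_mem_span_krylov` (ALL powers `τ^m w` lie in `O·{τ^j w : j < n}`, Cayley–Hamilton), `aeval_map_mulVec_mem_span_krylov` (`O[τ]` preserves
  the lattice), `exists_aeval_map_mulVec_eq_of_mem` (elements of the lattice are `p(τ) w`, `p ∈ O[X]`), `span_krylov_le_of_aeval_map_mulVec_eq`; **`span_krylov_eq_iff_exists_unit`** —
  `O·{τ^j w} = O·{τ^j w′} ⟺ ∃ p q ∈ O[X], q(τ) p(τ) = 1 ∧ w′ = p(τ) w` (for cyclic `w`; `w′` is then cyclic automatically).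

## References
* [Lang2002] S. Lang, *Algebra*, rev. 3rd ed., GTM 211 (2002): Ch. XIV §2 Thm. 2.1, §3 pp. 556–563 (cyclic modules `F[X]∕(f)`, the characteristic polynomial).
* [Jacobowitz1962] R. Jacobowitz, *Hermitian forms over local fields*, Amer. J. Math. 84 (1962): §7 (lattices of an order as a torsor under its units).
-/

set_option autoImplicit false

open Polynomial Matrix

namespace Literature.LinearAlgebra.Matrix

variable {F : Type*} [Field F] {n : ℕ}

/-! ## §1 Cyclic vectors: faithfulness, transitivity, the torsor -/

/-- **FAITHFULNESS**: a matrix commuting with `τ` that kills a cyclic vector of `τ` is zero. [cite: Lang2002, Ch. XIV §2 Thm. 2.1] -/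
theorem mulVec_eq_zero_of_commute_of_cyclic (τ A : Matrix (Fin n) (Fin n) F) (hA : A * τ = τ * A) {w : Fin n → F}
    (hw : Submodule.span F (Set.range fun j : Fin n => (τ ^ (j : ℕ)) *ᵥ w) = ⊤) (h0 : A *ᵥ w = 0) : A = 0 := by
  have hpow : ∀ j : ℕ, A * τ ^ j = τ ^ j * A := fun j => by
    induction j with
    | zero => simp
    | succ j ih => rw [pow_succ, ← mul_assoc, ih, mul_assoc, hA, ← mul_assoc]
  have hker : ∀ x : Fin n → F, A *ᵥ x = 0 := by
    intro x
    have hx : x ∈ Submodule.span F (Set.range fun j : Fin n => (τ ^ (j : ℕ)) *ᵥ w) := by rw [hw]; exact Submodule.mem_top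
    refine Submodule.span_induction (fun y hy => ?_) (by rw [Matrix.mulVec_zero]) (fun y z _ _ hy hz => by rw [Matrix.mulVec_add, hy, hz, add_zero])
      (fun a y _ hy => by rw [Matrix.mulVec_smul, hy, smul_zero]) hx
    obtain ⟨j, rfl⟩ := hy
    rw [Matrix.mulVec_mulVec, hpow, ← Matrix.mulVec_mulVec, h0, Matrix.mulVec_zero]
  ext i j
  have := congrFun (hker (Pi.single j 1)) i
  simpa [Matrix.mulVec, dotProduct, Pi.single_apply] using this

/-- Two matrices commuting with `τ` that agree on a cyclic vector are equal. [cite: Lang2002, Ch. XIV §2 Thm. 2.1] -/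
theorem eq_of_commute_of_mulVec_eq (τ A B : Matrix (Fin n) (Fin n) F) (hA : A * τ = τ * A) (hB : B * τ = τ * B) {w : Fin n → F}
    (hw : Submodule.span F (Set.range fun j : Fin n => (τ ^ (j : ℕ)) *ᵥ w) = ⊤) (h : A *ᵥ w = B *ᵥ w) : A = B := by
  have h0 : (A - B) *ᵥ w = 0 := by rw [Matrix.sub_mulVec, h, sub_self]
  have := mulVec_eq_zero_of_commute_of_cyclic τ (A - B) (by rw [Matrix.sub_mul, Matrix.mul_sub, hA, hB]) hw h0
  exact sub_eq_zero.1 this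

/-- `p(τ)` commutes with `τ`. [cite: Lang2002, Ch. XIV §3 p. 561] -/
theorem aeval_mul_comm (τ : Matrix (Fin n) (Fin n) F) (p : F[X]) : aeval τ p * τ = τ * aeval τ p := by
  have : aeval τ (p * X) = aeval τ (X * p) := by rw [mul_comm]
  simpa only [map_mul, aeval_X] using this

/-- `p(τ)` commutes with every power of `τ`. [cite: Lang2002, Ch. XIV §3 p. 561] -/
theorem aeval_mul_pow_comm (τ : Matrix (Fin n) (Fin n) F) (p : F[X]) (j : ℕ) : aeval τ p * τ ^ j = τ ^ j * aeval τ p :=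
  ((show Commute (aeval τ p) τ from aeval_mul_comm τ p).pow_right j).eq

/-- **TRANSITIVITY**: every vector is `p(τ) w` for a cyclic `w`, with `natDegree p < n` (or `p = 0`). [cite: Lang2002, Ch. XIV §2 Thm. 2.1] -/
theorem exists_aeval_mulVec_eq (τ : Matrix (Fin n) (Fin n) F) {w : Fin n → F}
    (hw : Submodule.span F (Set.range fun j : Fin n => (τ ^ (j : ℕ)) *ᵥ w) = ⊤) (w' : Fin n → F) :
    ∃ p : F[X], (∀ k, n ≤ k → p.coeff k = 0) ∧ aeval τ p *ᵥ w = w' := by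
  have hw' : w' ∈ Submodule.span F (Set.range fun j : Fin n => (τ ^ (j : ℕ)) *ᵥ w) := by rw [hw]; exact Submodule.mem_top
  obtain ⟨c, hc⟩ := (Submodule.mem_span_range_iff_exists_fun F).1 hw'
  refine ⟨∑ j : Fin n, C (c j) * X ^ (j : ℕ), fun k hk => ?_, ?_⟩
  · rw [finsetSum_coeff]
    refine Finset.sum_eq_zero fun j _ => ?_
    rw [coeff_C_mul, coeff_X_pow, if_neg (by have := j.2; omega), mul_zero]
  · rw [← hc, map_sum, Matrix.sum_mulVec]
    refine Finset.sum_congr rfl fun j _ => ?_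
    rw [map_mul, aeval_C, map_pow, aeval_X, Algebra.algebraMap_eq_smul_one, smul_mul_assoc, one_mul, Matrix.smul_mulVec]

/-- **THE TORSOR**: for a cyclic `w`, the vector `p(τ) w` is cyclic iff `p(τ)` is a unit of `M_n(F)` (then the transporter is unique by faithfulness: the cyclic vectors of `τ` form a
torsor under `F[τ]^×`). [cite: Lang2002, Ch. XIV §2 Thm. 2.1, §3] -/
theorem cyclic_iff_isUnit_aeval (τ : Matrix (Fin n) (Fin n) F) {w : Fin n → F}
    (hw : Submodule.span F (Set.range fun j : Fin n => (τ ^ (j : ℕ)) *ᵥ w) = ⊤) (p : F[X]) :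
    Submodule.span F (Set.range fun j : Fin n => (τ ^ (j : ℕ)) *ᵥ (aeval τ p *ᵥ w)) = ⊤ ↔ IsUnit (aeval τ p) := by
  constructor
  · intro hw'
    -- transport back: `w = q(τ) (p(τ) w)`, so `q(τ) p(τ) = 1` by faithfulness
    obtain ⟨q, -, hq⟩ := exists_aeval_mulVec_eq τ hw' w
    rw [Matrix.mulVec_mulVec] at hq
    have h1 : aeval τ q * aeval τ p = 1 :=
      eq_of_commute_of_mulVec_eq τ _ _ (by rw [mul_assoc, aeval_mul_comm, ← mul_assoc, aeval_mul_comm, mul_assoc]) (by rw [one_mul, mul_one]) hw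
        (by rw [hq, Matrix.one_mulVec])
    have h2 : aeval τ p * aeval τ q = 1 := by rw [← map_mul, mul_comm, map_mul, h1]
    exact ⟨⟨aeval τ p, aeval τ q, h2, h1⟩, rfl⟩
  · intro hu
    obtain ⟨u, hu⟩ := hu
    -- `span {τ^j (u w)} = u • span {τ^j w} = ⊤`
    rw [eq_top_iff]
    intro x _
    have hx : ((u⁻¹ : (Matrix (Fin n) (Fin n) F)ˣ) : Matrix (Fin n) (Fin n) F) *ᵥ x ∈ Submodule.span F (Set.range fun j : Fin n => (τ ^ (j : ℕ)) *ᵥ w) := by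
      rw [hw]; exact Submodule.mem_top
    have hux : x = (u : Matrix (Fin n) (Fin n) F) *ᵥ (((u⁻¹ : (Matrix (Fin n) (Fin n) F)ˣ) : Matrix (Fin n) (Fin n) F) *ᵥ x) := by
      rw [Matrix.mulVec_mulVec, ← Units.val_mul, mul_inv_cancel, Units.val_one, Matrix.one_mulVec]
    rw [hux]
    refine Submodule.span_induction (p := fun y _ => (u : Matrix (Fin n) (Fin n) F) *ᵥ y ∈ Submodule.span F (Set.range fun j : Fin n => (τ ^ (j : ℕ)) *ᵥ (aeval τ p *ᵥ w)))
      (fun y hy => ?_) (by rw [Matrix.mulVec_zero]; exact Submodule.zero_mem _)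
      (fun y z _ _ hy hz => by rw [Matrix.mulVec_add]; exact Submodule.add_mem _ hy hz)
      (fun a y _ hy => by rw [Matrix.mulVec_smul]; exact Submodule.smul_mem _ a hy) hx
    obtain ⟨j, rfl⟩ := hy
    rw [Matrix.mulVec_mulVec, hu]
    rw [aeval_mul_pow_comm, ← Matrix.mulVec_mulVec]
    exact Submodule.subset_span ⟨j, rfl⟩

/-! ## §2 The order `O[τ]` (`χ_τ ∈ O[X]`) and its lattices `O[τ]·w` -/

section Order

variable (O : Subring F)

/-- **Cayley–Hamilton over `O`**: if the characteristic polynomial of `τ` has coefficients in `O`, then EVERY power `τ^m w` lies in the `O`-span of `τ^j w`, `j < n`.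
[cite: Lang2002, Ch. XIV §3 Thm. 3.1 (Cayley–Hamilton)] -/
theorem pow_mulVec_mem_span_krylov (τ : Matrix (Fin n) (Fin n) F) (hτ : ∀ i, τ.charpoly.coeff i ∈ O) (w : Fin n → F) (m : ℕ) :
    (τ ^ m) *ᵥ w ∈ Submodule.span O (Set.range fun j : Fin n => (τ ^ (j : ℕ)) *ᵥ w) := by
  induction m using Nat.strong_induction_on with
  | _ m ih =>
    by_cases hm : m < n
    · exact Submodule.subset_span ⟨⟨m, hm⟩, rfl⟩
    · -- `τ^m = τ^(m-n) τ^n` and `τ^n = -Σ_{i<n} c_i τ^i`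
      have hmn : n ≤ m := Nat.le_of_not_lt hm
      have hCH := Matrix.aeval_self_charpoly τ
      have hmonic := Matrix.charpoly_monic τ
      have hdeg : τ.charpoly.natDegree = n := by rw [Matrix.charpoly_natDegree_eq_dim, Fintype.card_fin]
      rw [hmonic.as_sum, hdeg, map_add, map_pow, aeval_X, map_sum] at hCH
      have hτn : τ ^ n = -∑ i ∈ Finset.range n, τ.charpoly.coeff i • τ ^ i := by
        rw [eq_neg_iff_add_eq_zero, ← hCH]
        congr 1
        refine Finset.sum_congr rfl fun i _ => ?_
        rw [map_mul, aeval_C, map_pow, aeval_X, Algebra.algebraMap_eq_smul_one, smul_mul_assoc, one_mul]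
      have : (τ ^ m) *ᵥ w = -∑ i ∈ Finset.range n, τ.charpoly.coeff i • ((τ ^ (m - n + i)) *ᵥ w) := by
        rw [show m = (m - n) + n from (Nat.sub_add_cancel hmn).symm, pow_add, hτn, Matrix.mul_neg, Matrix.neg_mulVec, Finset.mul_sum, Matrix.sum_mulVec]
        congr 1
        refine Finset.sum_congr rfl fun i _ => ?_
        rw [Matrix.mul_smul, Matrix.smul_mulVec, ← pow_add, Nat.sub_add_cancel hmn]
      rw [this]
      refine Submodule.neg_mem _ (Submodule.sum_mem _ fun i hi => ?_)
      have hlt : m - n + i < m := by have := Finset.mem_range.1 hi; omega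
      have hmem := ih _ hlt
      -- `c_i ∈ O`: the `F`-scalar action by an element of `O` is the `O`-action
      have : τ.charpoly.coeff i • ((τ ^ (m - n + i)) *ᵥ w) = (⟨τ.charpoly.coeff i, hτ i⟩ : O) • ((τ ^ (m - n + i)) *ᵥ w) := rfl
      rw [this]
      exact Submodule.smul_mem _ _ hmem

/-- `O[τ]` preserves the lattice: for `p ∈ O[X]`, `p(τ)` maps `O·{τ^j w}` into itself. [cite: Lang2002, Ch. XIV §3] -/
theorem aeval_map_mulVec_mem_span_krylov (τ : Matrix (Fin n) (Fin n) F) (hτ : ∀ i, τ.charpoly.coeff i ∈ O) (w : Fin n → F) (p : O[X])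
    {x : Fin n → F} (hx : x ∈ Submodule.span O (Set.range fun j : Fin n => (τ ^ (j : ℕ)) *ᵥ w)) :
    aeval τ (p.map O.subtype) *ᵥ x ∈ Submodule.span O (Set.range fun j : Fin n => (τ ^ (j : ℕ)) *ᵥ w) := by
  -- reduce to monomials of `p` and generators `τ^j w`
  refine Submodule.span_induction (p := fun y _ => aeval τ (p.map O.subtype) *ᵥ y ∈ Submodule.span O (Set.range fun j : Fin n => (τ ^ (j : ℕ)) *ᵥ w))
    (fun y hy => ?_) (by rw [Matrix.mulVec_zero]; exact Submodule.zero_mem _)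
    (fun y z _ _ hy hz => by rw [Matrix.mulVec_add]; exact Submodule.add_mem _ hy hz)
    (fun a y _ hy => by
      have : aeval τ (p.map O.subtype) *ᵥ (a • y) = a • (aeval τ (p.map O.subtype) *ᵥ y) := by
        rw [show a • y = (a : F) • y from rfl, Matrix.mulVec_smul]; rfl
      rw [this]; exact Submodule.smul_mem _ a hy) hx
  obtain ⟨j, rfl⟩ := hy
  rw [aeval_eq_sum_range, Matrix.sum_mulVec]
  refine Submodule.sum_mem _ fun k _ => ?_
  rw [Matrix.smul_mulVec, Matrix.mulVec_mulVec, ← pow_add, coeff_map]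
  have : (O.subtype (p.coeff k)) • ((τ ^ (k + (j : ℕ))) *ᵥ w) = (p.coeff k) • ((τ ^ (k + (j : ℕ))) *ᵥ w) := rfl
  rw [this]
  exact Submodule.smul_mem _ _ (pow_mulVec_mem_span_krylov O τ hτ w _)

/-- Elements of the lattice `O·{τ^j w}` are of the form `p(τ) w` with `p ∈ O[X]`. [cite: Lang2002, Ch. XIV §2 Thm. 2.1] -/
theorem exists_aeval_map_mulVec_eq_of_mem (τ : Matrix (Fin n) (Fin n) F) (w : Fin n → F) {x : Fin n → F}
    (hx : x ∈ Submodule.span O (Set.range fun j : Fin n => (τ ^ (j : ℕ)) *ᵥ w)) :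
    ∃ p : O[X], aeval τ (p.map O.subtype) *ᵥ w = x := by
  obtain ⟨c, hc⟩ := (Submodule.mem_span_range_iff_exists_fun O).1 hx
  refine ⟨∑ j : Fin n, C (c j) * X ^ (j : ℕ), ?_⟩
  rw [← hc, Polynomial.map_sum, map_sum, Matrix.sum_mulVec]
  refine Finset.sum_congr rfl fun j _ => ?_
  rw [Polynomial.map_mul, Polynomial.map_pow, map_C, map_X, map_mul, aeval_C, map_pow, aeval_X, Algebra.algebraMap_eq_smul_one,
    smul_mul_assoc, one_mul, Matrix.smul_mulVec]
  rfl

/-- If `w′ = p(τ) w` with `p ∈ O[X]`, the lattice of `w′` lies in the lattice of `w`. [cite: Lang2002, Ch. XIV §3] -/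
theorem span_krylov_le_of_aeval_map_mulVec_eq (τ : Matrix (Fin n) (Fin n) F) (hτ : ∀ i, τ.charpoly.coeff i ∈ O) {w w' : Fin n → F} (p : O[X])
    (hp : aeval τ (p.map O.subtype) *ᵥ w = w') :
    Submodule.span O (Set.range fun j : Fin n => (τ ^ (j : ℕ)) *ᵥ w') ≤ Submodule.span O (Set.range fun j : Fin n => (τ ^ (j : ℕ)) *ᵥ w) := by
  refine Submodule.span_le.2 ?_
  rintro _ ⟨j, rfl⟩
  dsimp only
  rw [← hp, Matrix.mulVec_mulVec, ← aeval_mul_pow_comm, ← Matrix.mulVec_mulVec]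
  exact aeval_map_mulVec_mem_span_krylov O τ hτ w p (Submodule.subset_span ⟨j, rfl⟩)

/-- **`O[τ]·w = O[τ]·w′ ⟺ w′ ∈ O[τ]^× · w`** for cyclic `w, w′` and `χ_τ ∈ O[X]`: the two Krylov `O`-lattices coincide iff the transporter `w′ = p(τ) w` can be chosen with
`p ∈ O[X]` and an inverse `q(τ)`, `q ∈ O[X]` (faithfulness makes `q(τ)p(τ) = 1` automatic from `q(τ)w′ = w`). [cite: Lang2002, Ch. XIV §2 Thm. 2.1, §3] [cite: Jacobowitz1962, §7] -/
theorem span_krylov_eq_iff_exists_unit (τ : Matrix (Fin n) (Fin n) F) (hτ : ∀ i, τ.charpoly.coeff i ∈ O) {w w' : Fin n → F}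
    (hw : Submodule.span F (Set.range fun j : Fin n => (τ ^ (j : ℕ)) *ᵥ w) = ⊤) :
    Submodule.span O (Set.range fun j : Fin n => (τ ^ (j : ℕ)) *ᵥ w) = Submodule.span O (Set.range fun j : Fin n => (τ ^ (j : ℕ)) *ᵥ w') ↔
      ∃ p q : O[X], aeval τ (q.map O.subtype) * aeval τ (p.map O.subtype) = 1 ∧ aeval τ (p.map O.subtype) *ᵥ w = w' := by
  rcases Nat.eq_zero_or_pos n with hn | hn
  · subst hn
    exact ⟨fun _ => ⟨1, 1, by simp, Subsingleton.elim _ _⟩, fun _ => by rw [Set.range_eq_empty, Set.range_eq_empty]⟩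
  constructor
  · intro heq
    have hw'mem : w' ∈ Submodule.span O (Set.range fun j : Fin n => (τ ^ (j : ℕ)) *ᵥ w) := by
      rw [heq]; exact Submodule.subset_span ⟨⟨0, hn⟩, by simp⟩
    have hwmem : w ∈ Submodule.span O (Set.range fun j : Fin n => (τ ^ (j : ℕ)) *ᵥ w') := by
      rw [← heq]; exact Submodule.subset_span ⟨⟨0, hn⟩, by simp⟩
    obtain ⟨p, hp⟩ := exists_aeval_map_mulVec_eq_of_mem O τ w hw'mem
    obtain ⟨q, hq⟩ := exists_aeval_map_mulVec_eq_of_mem O τ w' hwmem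
    refine ⟨p, q, ?_, hp⟩
    refine eq_of_commute_of_mulVec_eq τ _ _ ?_ (by rw [one_mul, mul_one]) hw ?_
    · rw [mul_assoc, aeval_mul_comm, ← mul_assoc, aeval_mul_comm, mul_assoc]
    · rw [← Matrix.mulVec_mulVec, hp, hq, Matrix.one_mulVec]
  · rintro ⟨p, q, hqp, hp⟩
    have hq : aeval τ (q.map O.subtype) *ᵥ w' = w := by
      rw [← hp, Matrix.mulVec_mulVec, hqp, Matrix.one_mulVec]
    exact le_antisymm (span_krylov_le_of_aeval_map_mulVec_eq O τ hτ q hq) (span_krylov_le_of_aeval_map_mulVec_eq O τ hτ p hp)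

end Order

end Literature.LinearAlgebra.Matrix
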